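import Summits.QuantumFields.QCD.Theorems.CoerciveSea.Negative.PinWindow
import Literature.MathematicalPhysics.QuantumFieldTheory.QCDPhaseQuenched
import HarnessLib.Audit

/-!
# Line `moduli-spectral-averaging` — skeleton for crux `NestedDissectionSea.CoerciveSea`
(item stmt-QuantumFields-13901, route route-QuantumFields-NestedDissectionSea, sub-problem QCD)

Idea (card `Cruxes/CoerciveSea/Ideas/moduli-spectral-averaging.md`, triage r1-1/2/3: pass ×3, "make
(i-b) the typed stub with `N_c` counted on eigenvalues of `Γ₅·wilsonCell`, `K ≥ 2` explicit"): the
separator Wegner law (i) of the hinge, `P(HasSingularSeparator (t/s₀)) ≤ C t^α` uniformly in `k`,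
volume and window box, is split by the TWO-STEP transfer `TwoStepSea` into

* (i-a) a `t`-FREE MESOSCOPIC CENSUS — the phase-quenched expectation of the number `N_c(2K/s₀)` of
  singular values of the Dirichlet cell `D_c(m_f(k))` below `2K` Dirichlet-gap units is bounded,
  `E_pq[N_c(2K/s₀)] ≤ C₁` (all the non-perturbative weight, at `O(1)` resolution, no `t`);
* (i-b) RELATIVE SMEARING at resolution `t` — `E_pq[N_c(t/s₀)] ≤ C₂ · t · E_pq[N_c(2K/s₀)]`, `α = 1`,
  obtained by averaging NOT over links (dead line (α) of the card: Gibbs stiffness, no leverage) but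
  over the COLLECTIVE COORDINATES of the rare carrier of a near-gap-unit mode (position / size of a
  lump, amplitudes of the lowest cell-scale gluon modes), whose laws are flat on `O(1)` scales
  uniformly in `k` and along which the near-zero eigenvalue branch of `H_c = Γ₅ D_c` is TRANSVERSAL
  (law of motion: `Y λ = ⟨ψ, Γ₅ (Y D_c) ψ⟩`, chirality `= 1/κ ≠ 0` by `ChiralityPairing`);

then `P(HasSingularSeparator(t/s₀)) ≤ E_pq[N_c(t/s₀)] ≤ C₂ t E_pq[N_c(2K/s₀)] ≤ C₁ C₂ t` (event
inclusion + Markov, (i-b), (i-a)), and clauses (ii),(iii) of the hinge are the sibling crux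
`NegativeCellsDilute` VERBATIM (route support `DiluteOfCoercive` is the projection).

## Chain (five registered stubs, composed by `CoerciveSea_of` via `coerciveSeaAt_of_twoStep`, sorry-free)

* (M) `stub_firstMoment` — FIRST-MOMENT DOMINATION (deterministic + Markov, size M, provable now): the
  crux's phase-quenched probability of a `τ`-singular separator is at most the phase-quenched
  expectation (lintegral under `qcdLatticeMeasure`) of the near-kernel count `N_c(τ)` of the cell:
  `HasSingularSeparator U μ s τ ⇒ σ_min(D_c) < τ ⇒ N_c(τ) ≥ 1` (landed
  `CoerciveSeaNegative.hasSingularSeparator_cell_residual_lt` + Rayleigh), then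
  `ofReal ∫ 1_E ≤ ∫⁻ 1_E ≤ ∫⁻ N_c` (`enorm_integral_le_lintegral_enorm`; no measurability needed) and
  `qcdPhaseQuenchedExpect_eq_div_prod` /
  `…_eq_integral_qcdLatticeMeasure` to identify the crux's quotient.
* (D) `stub_dilutionPin` — the route's rank-2 crux `NegativeCellsDilute` (stmt-QuantumFields-13900) BY
  NAME: it supplies the witness regularisation `reg` on the PHYSICAL branch (pin (iii), Disproof Part C)
  together with (ii),(iii); this line adds nothing to it and is CLOSED BY that item.
* (A) `stub_mesoscopicCensus` — (i-a) along any data `(reg, M₀, b₀, ℓ)` on the physical branch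
  (`OnPhysicalBranch` = admissible scalings + (ii) + (iii)): open, size XL, the `t`-free
  non-perturbative input shared with every line on this crux (lump census at the UV-convergent end +
  Gaussian large deviations at scale `s`; "what `SmallFieldSeparatorGap`/`LumpLifting` give at
  `t = 2K`"); it is where a Golterman–Shamir localised-mode population would kill the crux
  (Disproof Part D), never in (i-b).
* (W) `stub_transversalDwell` — the FINITE-DIMENSIONAL HEART, abstract and provable now (size L):
  a `T`-periodic `C¹` family of Hermitian matrices whose eigenvectors with eigenvalue in `(−η₀, η₀)`
  are transversal (`|⟨v, H′ v⟩| ≥ v₀ ‖v‖²`, leverage) and not too fast (`|⟨v, H′ v⟩| ≤ L ‖v‖²`, speed)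
  spends, per period, at most `(η L)/(η₀ v₀)` times as long with an eigenvalue in `(−η, η)` as in
  `(−η₀, η₀)`:
  `∫₀ᵀ N(η) ≤ (ηL/(η₀v₀)) ∫₀ᵀ N(η₀)` (Kato's `C¹` eigenvalue branches, Thm II.6.8; each branch is
  monotone on every excursion through the big window). This is the Erdős–Hasler "sum of squares of
  `Y_z λ` bounded below" mechanism (arXiv:1012.5185 §4) in DWELL-TIME form: no integration by parts,
  no `C²` density, no semibounded operator and no far-spectrum trace `Tr G(H)` (triage r1-3 (1′)) —
  the density along the loop enters only through `sup ρ / inf ρ` when the lemma is applied.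
* (S) `stub_moduliSmearing` — THE BET (hardest stub; open, XL): `TransversalDwell → (i-b)` on the
  physical branch. Content = the card's R2 + R3: ATTACH every near-`2K`-gap-unit mode of a window
  cell (valence mass, pinned `reg`) to a carrier with a collective coordinate realised as a measurable
  LOOP in gauge-configuration space (interpolated lattice translation of the lump relative to the
  cell, period `N`; right-multiplication `U ↦ U·exp(iθA)` by a cell-scale gluon mode, Haar-invariant)
  along which (a) the phase-quenched density has `sup/inf ≤ e^{O(1)}` uniformly in `k` (translation
  invariance `wilsonMeasure_map_torusConfigShift`; stiffness `β(a/ρ)² → 0` for `ρ ≳ ρ_*`), (b) window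
  branches have speed `≤ L = O(1/s₀)` and leverage `≥ v₀ = Ω(1/s₀)` per unit coordinate
  (transversality of the lifted-mode function `F` on the carrier's moduli — the card's falsifier F1),
  then apply (W) fibrewise with `η = t/s₀`, `η₀ = 2K/s₀` and integrate: `C₂ = (L/v₀)(sup ρ/inf ρ)/(2K)`.

Glue: `coerciveSeaAt_of_twoStep` (sorry-free, hypotheses by name: `FirstMomentDomination`,
`OnPhysicalBranch`, `MesoscopicCensusAt`, `RelativeSmearingAt` ⊢ `CoerciveSeaNegative.CoerciveSeaAt Nf reg`,
the crux body after `∃ reg` — reusable by any line proving (i-a),(i-b)): the branch data give, for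
every `m > M₀`, `R₀` with (ii),(iii); (S) gives `K ≥ 2, C₂, R₂`; (A) at that `K` gives `C₁, R₁`; with
`R = max R₀ (max R₁ R₂)`, `C = C₁ C₂`, `α = 1`, eventually in `k` (two eventualities), for every
admissible torus, window box, flavour and `t ∈ (0,1]`:
`ofReal P = ofReal ⟨1_E⟩₊ ≤ ∫⁻ N_c(t/s₀) ≤ ofReal(C₂ t) ∫⁻ N_c(2K/s₀) ≤ ofReal(C₂ t C₁)`
(`qcdPhaseQuenchedExpect_eq_div_prod`, M, S, A) and `t = t^1`; (ii),(iii) at `R ≥ R₀` by restricting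
the tori. `CoerciveSea_of` = (D) repacked as `OnPhysicalBranch` + the stubs + this transfer.

## Disproof.lean (cdisprove cycle 1, NO KILL) — obligations honoured

* Part C `coerciveSeaWithoutPin_holds` / `heavyJunk_dichotomy` (any proof must use the pin to sit on
  the physical branch): the pin is CONSUMED — (A) and (S) are stated only under `OnPhysicalBranch`
  (which contains `PinClause` and the dilution (ii)), and the witness `reg` of `CoerciveSea_of` is the
  one produced by `NegativeCellsDilute`; for the junk witness `mcrit ≡ 1` the hypothesis is false
  (`not_coerciveSeaAt_heavyJunkReg`), so no stub is junk-provable through it.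
* Part B `hasSingularSeparator_cell_residual_lt` (event ⊆ cell near-kernel) is exactly the
  deterministic half of (M); `hasSingularSeparator_mass_lt` (`μ < |τ|`): the counts are taken at the
  pinned valence masses `m_f(k) ∈ (−8, 0) + o(1)` (`PinClause.mass_mem_Ioo`), where `KineticEdge` gives
  the carriers moduli.
* Part D `physicsMargins` (content = k-UNIFORMITY; threat = localised near-zero modes of density
  `≳ a_k³`): located in (A) (a `t`-free statement), not in (S); a refuter kills this line cheapest by a
  lower bound on `E_pq[N_c(2K/s₀)]` growing across the window.
* Landed `Theorems/CoerciveSea/Negative/{SeilerBothSides, CellCoercivity, CellDeterminants, PinWindow}`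
  are IMPORTED here; no stub is an instance they refute (they refute junk corners `mcrit ∉ (−8,0]`,
  which `OnPhysicalBranch` excludes, and bound nothing on the physical branch).
* Negatives index (9494 AdaptiveCoarseSystem, 9599/9603 MultibosonBridge, 9665 MirrorModularBoosts):
  no stub is a `∀ U` two-sided coercivity claim; (M),(W) are exact finite-dimensional statements,
  (A),(S) are statements in probability.

`lean check`: rc 0, sorries only in the five `stub_*`; `CoerciveSea_of` concludes
`Summit.QuantumFields.QCD.Theses.NestedDissectionSea.CoerciveSea` BY NAME. Stub signatures use only
importable declarations plus the vocabulary of THIS file (`nearKernelCount`, `valenceMass`,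
`IsWindowBox`, `DilutionClause`, `OnPhysicalBranch`, `MesoscopicCensusAt`, `RelativeSmearingAt`,
`TransversalDwell`, `FirstMomentDomination`); a stub prover either works in this file (lead) or imports it as
`Summits.QuantumFields.QCD.Cruxes.CoerciveSea.Lines.moduli_spectral_averaging`.
-/

noncomputable section

open scoped BigOperators ComplexConjugate Classical ENNReal
open MeasureTheory Filter Matrix
open Literature.MathematicalPhysics.QuantumLattice Literature.MathematicalPhysics.QuantumFieldTheory
  Literature.Probability.LatticeModels
open Summit.QuantumFields.QCD.Theses.NestedDissectionSea (CoerciveSea NegativeCellsDilute)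
open Summit.QuantumFields.QCD.Theorems.CoerciveSeaNegative (PinClause)

set_option linter.dupNamespace false

namespace Summit.QuantumFields.QCD.Cruxes.CoerciveSea.ModuliSpectralAveraging

/-! ## Vocabulary of the line (definitions, no content) -/

section Vocabulary

variable {Nt : ℕ} [NeZero Nt]

/-- **Near-kernel count** `N_c(τ; U, μ, s)`: the number of singular values of the Dirichlet cell
`D_c = wilsonCell U μ 0 s` strictly below `τ`, i.e. of eigenvalues of `D_cᴴ D_c` below `τ²`
(with multiplicity). Since `Γ₅|_c` is unitary and `H_c = Γ₅|_c D_c` is Hermitian with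
`H_c² = D_cᴴ D_c`, this is also the number of eigenvalues of `H_c` in `(−τ, τ)` — the `N_c` of the
card and of triage r1-1's sharpening. -/
def nearKernelCount (U : GaugeConfig 4 Nt SU3) (μ : ℝ) (s : Fin 4 → ℕ) (τ : ℝ) : ℕ :=
  Fintype.card
    {i // (Matrix.isHermitian_conjTranspose_mul_self (wilsonCell U μ 0 s)).eigenvalues i < τ ^ 2}

/-- The bare valence masses `m_f(k) = mcrit k + a_k m_f / Z_m k` of the crux (its `let mq`,
verbatim as a function). -/
def valenceMass {Nf : ℕ} (reg : QCDRegularisation Nf) (m : Fin Nf → ℝ) (k : ℕ) : Fin Nf → ℝ :=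
  fun f => reg.mcrit k + reg.a k * m f / reg.Zm k

/-- **Window box** of clause (i): a roughly cubic corner-`0` box of sides `s` with
`b₀ ≤ s_i ≤ N`, `s_i a_k ≤ ℓ`, `s_i ≤ 2 s_j` (the two box hypotheses of the crux, bundled). -/
def IsWindowBox {Nf : ℕ} (reg : QCDRegularisation Nf) (b₀ : ℕ) (ℓ : ℝ) (k N : ℕ) (s : Fin 4 → ℕ) :
    Prop :=
  (∀ i, b₀ ≤ s i ∧ s i ≤ N ∧ (s i : ℝ) * reg.a k ≤ ℓ) ∧ ∀ i j, s i ≤ 2 * s j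

/-- **Clause (ii) of the crux — windowed local dilution — VERBATIM** (= clause (a) of
`NegativeCellsDilute`), for given `Nf, reg, b₀, ℓ`, mass tuple `m` and physical size `R`. -/
def DilutionClause (Nf : ℕ) (reg : QCDRegularisation Nf) (b₀ : ℕ) (ℓ : ℝ) (m : Fin Nf → ℝ) (R : ℝ) :
    Prop :=
  ∀ ε : ℝ, 0 < ε → ∀ᶠ k : ℕ in Filter.atTop, ∀ S : ℕ, R ≤ reg.a k * (2 * S + 1) → let N : ℕ := 2 * S + 1; let mq : Fin Nf → ℝ := fun f => reg.mcrit k + reg.a k * m f / reg.Zm k; let wt : GaugeConfig 4 N (Matrix.specialUnitaryGroup (Fin 3) ℂ) → ℝ := fun U => ∏ f, ‖fermionDet (wilsonDirac (fundamentalRep (Fin 3)) U (mq f) 1)‖; let P : (GaugeConfig 4 N (Matrix.specialUnitaryGroup (Fin 3) ℂ) → Prop) → ℝ := fun E => (∫ U, (if E U then (1 : ℝ) else 0) * wt U ∂(wilsonMeasure (d := 4) (L := N) (fundamentalRep (Fin 3)) (reg.β k))) / (∫ U, wt U ∂(wilsonMeasure (d := 4) (L := N) (fundamentalRep (Fin 3))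 (reg.β k))); let J : ℕ := Nat.log 2 (⌊ℓ / reg.a k⌋₊ / b₀) + 1; ∃ δ : ℕ → ℝ, ∑ j ∈ Finset.range J, δ j ≤ ε ∧ ∀ j < J, ∀ s : Fin 4 → ℕ, (∀ i, b₀ * 2 ^ j ≤ s i ∧ s i < b₀ * 2 ^ (j + 2) ∧ s i ≤ N ∧ (s i : ℝ) * reg.a k ≤ ℓ) → P (fun U => ∃ f, IsSignDefect U (mq f) j s) ≤ δ j

/-- **The data sit on the PHYSICAL BRANCH**: admissible scalings, `0 ≤ M₀`, `2 ≤ b₀`, `0 < ℓ`, and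
for every mass tuple above threshold some physical size `R` carrying the windowed dilution (ii) and
the parity pin (iii) — i.e. EXACTLY the body of `NegativeCellsDilute` after its `∃ reg … ∃ ℓ` prefix,
repacked over `DilutionClause` and the landed `CoerciveSeaNegative.PinClause`. By Disproof Part A/C
this pins `mcrit k` to `(−8, 0] + a_k M₀/Z_m k` and excludes every junk regularisation; it is the
hypothesis under which (i-a) and (i-b) are claimed. -/
def OnPhysicalBranch (Nf : ℕ) (reg : QCDRegularisation Nf) (M₀ : ℝ) (b₀ : ℕ) (ℓ : ℝ) : Prop :=
  reg.HasMassScaling ∧ (reg.scheme 0 0 0).HasAsymptoticScaling ∧ 0 ≤ M₀ ∧ 2 ≤ b₀ ∧ 0 < ℓ ∧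
    ∀ m : Fin Nf → ℝ, (∀ f, M₀ < m f) → ∃ R : ℝ, 0 < R ∧
      DilutionClause Nf reg b₀ ℓ m R ∧ PinClause Nf reg M₀ m R

/-- **(i-a) MESOSCOPIC CENSUS at `(reg, M₀, b₀, ℓ)`**: for every mass tuple above threshold and every
resolution `K ≥ 2` there are `C₁ > 0` and a physical size `R` such that, eventually in `k`, on every
odd torus of physical side `≥ R`, for every window box and flavour, the phase-quenched expectation of
the number of singular values of the valence-mass Dirichlet cell below `2K/s₀` is at most `C₁`
(`t`-free; merely finite is enough). -/
def MesoscopicCensusAt (Nf : ℕ) (reg : QCDRegularisation Nf) (M₀ : ℝ) (b₀ : ℕ) (ℓ : ℝ) : Prop :=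
  ∀ m : Fin Nf → ℝ, (∀ f, M₀ < m f) → ∀ K : ℝ, 2 ≤ K →
    ∃ C₁ : ℝ, 0 < C₁ ∧ ∃ R : ℝ, 0 < R ∧ ∀ᶠ k : ℕ in Filter.atTop, ∀ S : ℕ,
      R ≤ reg.a k * (2 * S + 1) → ∀ s : Fin 4 → ℕ, IsWindowBox reg b₀ ℓ k (2 * S + 1) s →
        ∀ f : Fin Nf,
          ∫⁻ U, (nearKernelCount U (valenceMass reg m k f) s (2 * K / s 0) : ℝ≥0∞)
              ∂(qcdLatticeMeasure (2 * S + 1) (reg.β k) (valenceMass reg m k)) ≤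
            ENNReal.ofReal C₁

/-- **(i-b) RELATIVE SMEARING at `(reg, M₀, b₀, ℓ)`** (Hölder-`1` continuity of the averaged counting
function relative to its own mesoscopic value): for every mass tuple above threshold there are
`K ≥ 2`, `C₂ > 0` and `R` such that, eventually in `k`, on every odd torus of physical side `≥ R`, for
every window box, flavour and `t ∈ (0, 1]`,
`E_pq[N_c(t/s₀)] ≤ C₂ · t · E_pq[N_c(2K/s₀)]` (lintegrals under `qcdLatticeMeasure`). -/
def RelativeSmearingAt (Nf : ℕ) (reg : QCDRegularisation Nf) (M₀ : ℝ) (b₀ : ℕ) (ℓ : ℝ) : Prop :=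
  ∀ m : Fin Nf → ℝ, (∀ f, M₀ < m f) →
    ∃ K : ℝ, 2 ≤ K ∧ ∃ C₂ : ℝ, 0 < C₂ ∧ ∃ R : ℝ, 0 < R ∧ ∀ᶠ k : ℕ in Filter.atTop, ∀ S : ℕ,
      R ≤ reg.a k * (2 * S + 1) → ∀ s : Fin 4 → ℕ, IsWindowBox reg b₀ ℓ k (2 * S + 1) s →
        ∀ f : Fin Nf, ∀ t : ℝ, 0 < t → t ≤ 1 →
          ∫⁻ U, (nearKernelCount U (valenceMass reg m k f) s (t / s 0) : ℝ≥0∞)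
              ∂(qcdLatticeMeasure (2 * S + 1) (reg.β k) (valenceMass reg m k)) ≤
            ENNReal.ofReal (C₂ * t) *
              ∫⁻ U, (nearKernelCount U (valenceMass reg m k f) s (2 * K / s 0) : ℝ≥0∞)
                ∂(qcdLatticeMeasure (2 * S + 1) (reg.β k) (valenceMass reg m k))

end Vocabulary

/-- **First-moment domination** (statement of stub (M)): for every torus side `Nt`, coupling `β`, sea
masses `mq`, cell mass `μ`, box `s` and level `τ > 0`, the phase-quenched probability
`⟨1_E⟩₊ = qcdPhaseQuenchedExpect β Nt mq 1_E` of a `τ`-singular separator of the corner-`0` box is at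
most the phase-quenched expectation (lower Lebesgue integral under `qcdLatticeMeasure Nt β mq`) of
the near-kernel count `N_c(τ)` of its Dirichlet cell. -/
def FirstMomentDomination : Prop :=
  ∀ {Nf : ℕ} (Nt : ℕ) [NeZero Nt] (β : ℝ) (mq : Fin Nf → ℝ) (μ : ℝ) (s : Fin 4 → ℕ) (τ : ℝ), 0 < τ →
    ENNReal.ofReal (qcdPhaseQuenchedExpect β Nt mq
        (fun U => if HasSingularSeparator U μ s τ then (1 : ℝ) else 0)) ≤
      ∫⁻ U, (nearKernelCount U μ s τ : ℝ≥0∞) ∂(qcdLatticeMeasure Nt β mq)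

/-- **Transversal dwell-time inequality** (the abstract relative Wegner estimate; finite-dimensional,
provable now). Let `θ ↦ H θ` be a `T`-periodic family of Hermitian `n × n` matrices, entrywise `C¹`
with derivative `H′` (`HasDerivAt` + continuity; any finite index type), such that every eigenvector
`v` of `H θ` with eigenvalue `c` in the big window `|c| < η₀` has (transversality / leverage)
`|⟨v, H′ θ v⟩| ≥ v₀ ‖v‖²`, `v₀ > 0`, and (speed) `|⟨v, H′ θ v⟩| ≤ L ‖v‖²` — both asked ONLY of
window eigenvectors. Then for `0 < η ≤ η₀` the time per period spent with eigenvalues in the small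
window is relatively small:
`∫₀ᵀ #{i : |λ_i(θ)| < η} dθ ≤ (η L / (η₀ v₀)) · ∫₀ᵀ #{i : |λ_i(θ)| < η₀} dθ`.
Proof sketch: choose `C¹` eigenvalue branches `μ_a` (Kato, Perturbation theory, Thm II.6.8 — `C¹`
Hermitian families on an interval have `C¹` enumerations of their repeated eigenvalues, with
`μ_a′(θ) = ⟨v, H′ v⟩` for a unit eigenvector `v` of `H θ` — Kato Thm II.5.4: the derivatives of the
`λ`-group are the eigenvalues of `P H′ P`); on each connected component `I` of
`{|μ_a| < η₀}` the derivative has constant sign, so `μ_a` is strictly monotone, `I` is bounded and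
traverses `(−η₀, η₀)` fully: `|I| ≥ 2η₀/L`, while `|{θ ∈ I : |μ_a θ| < η}| ≤ 2η/v₀`; summing over
branches and components inside `(0, mT)` and letting `m → ∞` (periodicity of the multiset of
eigenvalues; at most `2n` components meet the endpoints) removes boundary effects. Corollary used by
`stub_moduliSmearing`: against a density `ρ` on the circle the same holds with an extra factor
`sup ρ / inf ρ`. (Both integrands are bounded; if Lean's interval integral saw them as
non-measurable both sides would be `0`.) -/
def TransversalDwell : Prop :=
  ∀ (ι : Type) [Fintype ι] [DecidableEq ι] (H H' : ℝ → Matrix ι ι ℂ) (hH : ∀ θ, (H θ).IsHermitian)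
    (T L v₀ η₀ η : ℝ),
    0 < T → 0 < v₀ → 0 < η → η ≤ η₀ →
    (∀ θ, H (θ + T) = H θ) →
    (∀ θ i j, HasDerivAt (fun θ' => H θ' i j) (H' θ i j) θ) →
    (∀ i j, Continuous fun θ => H' θ i j) →
    (∀ θ (v : ι → ℂ) (c : ℝ), v ≠ 0 → H θ *ᵥ v = (c : ℂ) • v → |c| < η₀ →
        v₀ * ∑ i, ‖v i‖ ^ 2 ≤ ‖star v ⬝ᵥ (H' θ *ᵥ v)‖ ∧
          ‖star v ⬝ᵥ (H' θ *ᵥ v)‖ ≤ L * ∑ i, ‖v i‖ ^ 2) →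
    ∫ θ in (0 : ℝ)..T, (Fintype.card {i // |(hH θ).eigenvalues i| < η} : ℝ) ≤
      η * L / (η₀ * v₀) * ∫ θ in (0 : ℝ)..T, (Fintype.card {i // |(hH θ).eigenvalues i| < η₀} : ℝ)

/-! ## Stubs -/

/-- **Stub (M) — first-moment domination `FirstMomentDomination` (deterministic + Markov; size M,
provable now).**
For every torus side `Nt`, coupling `β`, sea masses `mq`, cell mass `μ`, box `s` and level `τ > 0`:
the phase-quenched probability `⟨1_E⟩₊ = qcdPhaseQuenchedExpect β Nt mq 1_E` (which IS the crux's
literal quotient `∫ 1_E ∏_f |det D_W(m_f)| dμ_W / ∫ ∏_f |det D_W(m_f)| dμ_W` by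
`qcdPhaseQuenchedExpect_eq_div_prod`, the rewrite used in `CoerciveSea_of`) that the corner-`0` box
has a `τ`-singular separator at mass `μ` is at most the phase-quenched expectation of the
near-kernel count `N_c(τ)` of its Dirichlet cell, written as a lower Lebesgue integral against
`qcdLatticeMeasure Nt β mq` (= that probability measure, `qcdPhaseQuenchedExpect_eq_integral_qcdLatticeMeasure`).
Deterministic input: `HasSingularSeparator U μ s τ → ∃ w ≠ 0, ‖D_c w‖² < τ²‖w‖²`
(`CoerciveSeaNegative.hasSingularSeparator_cell_residual_lt`, landed) and Rayleigh
(`λ_min(D_cᴴD_c) ≤ ‖D_c w‖²/‖w‖²`), so `1_E ≤ N_c(τ)` pointwise; then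
`ofReal ∫ 1_E dν ≤ ‖∫ 1_E dν‖ₑ ≤ ∫⁻ 1_E dν ≤ ∫⁻ N_c(τ) dν` (`enorm_integral_le_lintegral_enorm`,
`lintegral_mono`)
— no measurability of `U ↦ N_c` is needed for the inequality. [folklore] -/
theorem stub_firstMoment : FirstMomentDomination := by
  sorry

/-- **Stub (D) — clauses (ii),(iii) and the witness regularisation = the route's rank-2 crux
`NegativeCellsDilute` (stmt-QuantumFields-13900) BY NAME.** The hinge's clauses (ii)–(iii) ARE this
item (support `DiluteOfCoercive`, term-checked); every line on clause (i) imports it, and this stub is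
closed by any proof of that item (`exact negativeCellsDilute_holds`-style), never by this line.
Why it might fail: as the item (pair-collision carriers with an Aoki-type band ∝ `a`; pin band).
[cite: MohlerSchaefer2020, §2.1] -/
theorem stub_dilutionPin : NegativeCellsDilute := by
  sorry

/-- **Stub (A) — (i-a) MESOSCOPIC CENSUS on the physical branch (open; size XL; `t`-free).**
For `N_f ∈ {2,3}` and any `(reg, M₀, b₀, ℓ)` on the physical branch, `MesoscopicCensusAt` holds: the
expected number of singular values of the valence-mass Dirichlet cell of a window box below `2K`
Dirichlet-gap units is bounded uniformly in `k`, volume and box. Why plausibly true: for the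
SF-like typical cell it is Weyl's law at resolution `2K` gap units (`≲ K⁴` levels, `s`-independent —
sibling toy j008492 saw no `s²`/`log s` growth); lumps of size `ρ ≤ s` contribute their crossing
modes weighted by the UV-convergent density `(ρ a_kΛ)^b ρ^{-5} dρ`, `b − 4 ≥ 5`, i.e. `≲ C_N (ℓΛ)^b`;
the Gaussian sector is a large deviation of the lowest level. Why it might fail: a Golterman–Shamir
population of localised near-zero modes of density `≳ a_k³` per site at the valence line (Disproof
Part D) makes `E N_c(2K/s₀)` grow like `s³ a_k³ → (ℓ)³` … across the window — i.e. NOT uniformly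
bounded as `s ↑ ℓ/a_k` if the density does not scale; femto-window bet (`g²(ℓ)` small) as the crux.
Tools: Bałaban small/large-field decomposition up to scale `s` (Balaban1988Convergent,
Balaban1989LargeFieldII), admissibility/Lüscher charge for the lump census (Luscher1982Topology),
`KineticEdge` for the small-box cut-off. [cite: Wegner1981DensityOfStates] [cite: FrohlichSpencer1983]
[cite: EdwardsHellerNarayananInstanton1998] [cite: MohlerSchaefer2020, §2.1] -/
theorem stub_mesoscopicCensus :
    ∀ (Nf : ℕ), (Nf = 2 ∨ Nf = 3) → ∀ (reg : QCDRegularisation Nf) (M₀ : ℝ) (b₀ : ℕ) (ℓ : ℝ),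
      OnPhysicalBranch Nf reg M₀ b₀ ℓ → MesoscopicCensusAt Nf reg M₀ b₀ ℓ := by
  sorry

/-- **Stub (W) — the transversal dwell-time inequality `TransversalDwell` (abstract relative Wegner
estimate; finite-dimensional; size L; provable now).** See the docstring of `TransversalDwell` for
statement and proof sketch (Kato Thm II.6.8 `C¹` branches; monotone excursions; unrolling over `m`
periods). Erdős–Hasler's device (lower bound on `Σ_z (Y_z λ)²` instead of a signed `Y λ`,
arXiv:1012.5185 §4, Lemma 6) in a form without integration by parts. Leans on: Mathlib
`Matrix.IsHermitian.eigenvalues`, `intervalIntegral`, `HasDerivAt`; no project declaration.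
[cite: ErdosHasler2012, §4] [cite: Kato1966, Thm II.6.8] -/
theorem stub_transversalDwell : TransversalDwell := by
  sorry

/-- **Stub (S) — MODULI SMEARING: `TransversalDwell → (i-b)` on the physical branch (THE BET; hardest
stub; open, size XL).** For `N_f ∈ {2,3}` and `(reg, M₀, b₀, ℓ)` on the physical branch,
`RelativeSmearingAt` holds: `E_pq[N_c(t/s₀)] ≤ C₂ t E_pq[N_c(2K/s₀)]` for window boxes, eventually in
`k`, with `K ≥ 2`, `C₂` independent of `k`, volume, box. Mechanism (card): every mode of the
valence-mass cell within `2K` gap units of zero sits on a CARRIER with collective coordinates —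
a chiral lump (position `y ∈` cell, relative size `r`; `KineticEdge`: carriers are smooth on scale
`s_free(k) → ∞`; `ChiralityPairing`: chirality `= 1/κ ≠ 0`) or the lowest cell-scale gluon modes of
the lump-free (Gaussian) sector; along a LOOP in configuration space moving one such coordinate
(interpolated lattice translation of the configuration relative to the cell — exact invariance
`wilsonMeasure_map_torusConfigShift` at integer shifts, Jacobian/stiffness `≍ β_k (a_k/ρ)² → 0` in
between for `ρ ≳ ρ_* ∝ a_k^{-1/2}`; or `U ↦ U·exp(iθA)`, Haar-invariant, Gibbs tilt `e^{O(1)}` over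
`O(1)` widths) the phase-quenched density has bounded `sup/inf`, the near-zero branch of
`H_c = Γ₅|_c D_c` moves by `Y λ = ⟨ψ, Γ₅ (Y D_c) ψ⟩` (law of motion, `lawOfMotionSolvability_holds`)
with speed `≤ L ≍ 1/s₀` and — the deterministic heart — LEVERAGE `≥ v₀ ≍ 1/s₀` (transversality of the
lifted-mode function `F(r, y)` of the SF/Dirichlet box in a one-lump background: no critical VALUE at
the resonance level; Morse critical points in dimension ≥ 2 still integrate to a `t`-linear law —
triage r1-2 (2)); `TransversalDwell` fibrewise with `η = t/s₀`, `η₀ = 2K/s₀`, then Fubini over the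
loop foliation: `C₂ = (L/v₀)·(sup ρ/inf ρ)/(2K)`. Equivalent reading: the window-averaged density of
states of `H_c(m_f(k))` has NO SPIKE at `0` relative to its mean over `(−2K/s₀, 2K/s₀)` — crossing
masses of carriers are smooth functions of flat-distributed moduli. Why it might fail: (R2) an
un-attached population of near-gap-unit modes without an `O(1)`-leverage coordinate (lattice-scale
dislocations crossing near the valence mass — excluded by `KineticEdge` only eventually in `k`;
extended SF-level fluctuations whose only handles are gluon modes with leverage `g/s ≪ 1/s`, dead line
(β) of the card) would need its OWN relative smoothness; (F1) a flat direction of `F` on the lump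
moduli (`C₂ = ∞` for that class). Honest price (R3): the loop must act on the RENORMALISED field at the
carrier's scale (inside a Bałaban small-field representation), not on bare links (triage r1-1 (P2)).
[cite: ErdosHasler2012, §4] [cite: Wegner1981DensityOfStates] [cite: CombesHislopMourre1996]
[cite: EdwardsHellerNarayananInstanton1998] [cite: tHooft1976] [cite: Balaban1989LargeFieldII] -/
theorem stub_moduliSmearing :
    TransversalDwell →
      ∀ (Nf : ℕ), (Nf = 2 ∨ Nf = 3) → ∀ (reg : QCDRegularisation Nf) (M₀ : ℝ) (b₀ : ℕ) (ℓ : ℝ),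
        OnPhysicalBranch Nf reg M₀ b₀ ℓ → RelativeSmearingAt Nf reg M₀ b₀ ℓ := by
  sorry

/-! ## Glue (sorry-free) -/

/-- **The transfer `TwoStepSea → CoerciveSea` at a fixed regularisation** (deterministic, sorry-free,
reusable by any line that proves (i-a) and (i-b)): first-moment domination, the physical-branch data
(which carry (ii),(iii) at some `R₀` for each `m`), the mesoscopic census and the relative smearing at
`(reg, M₀, b₀, ℓ)` give the crux body `CoerciveSeaAt Nf reg` (landed `CoerciveSeaNegative.CoerciveSeaAt`,
the crux after `∃ reg`, verbatim) with `C = C₁ C₂`, `α = 1`, `R = max R₀ (max R₁ R₂)`. -/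
theorem coerciveSeaAt_of_twoStep {Nf : ℕ} {reg : QCDRegularisation Nf} {M₀ : ℝ} {b₀ : ℕ} {ℓ : ℝ}
    (hM : FirstMomentDomination) (hb : OnPhysicalBranch Nf reg M₀ b₀ ℓ)
    (hA : MesoscopicCensusAt Nf reg M₀ b₀ ℓ) (hS : RelativeSmearingAt Nf reg M₀ b₀ ℓ) :
    Summit.QuantumFields.QCD.Theorems.CoerciveSeaNegative.CoerciveSeaAt Nf reg := by
  obtain ⟨hms, has, hM₀, hb₀, hℓ, hbody⟩ := hb
  refine ⟨hms, has, M₀, hM₀, b₀, hb₀, ℓ, hℓ, fun m hm => ?_⟩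
  obtain ⟨R₀, hR₀, hii, hiii⟩ := hbody m hm
  obtain ⟨K, hK, C₂, hC₂, R₂, hR₂, hsm⟩ := hS m hm
  obtain ⟨C₁, hC₁, R₁, hR₁, hce⟩ := hA m hm K hK
  refine ⟨max R₀ (max R₁ R₂), lt_max_of_lt_left hR₀, ?_, ?_, ?_⟩
  · -- clause (i): separator Wegner law with C = C₁ C₂, α = 1
    refine ⟨C₁ * C₂, mul_pos hC₁ hC₂, 1, one_pos, ?_⟩
    filter_upwards [hsm, hce] with k hk₂ hk₁
    intro S hS N mq wt P s hs hs2 f t ht0 ht1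
    have hS₁ : R₁ ≤ reg.a k * (2 * S + 1) :=
      le_trans (le_trans (le_max_left _ _) (le_max_right _ _)) hS
    have hS₂ : R₂ ≤ reg.a k * (2 * S + 1) :=
      le_trans (le_trans (le_max_right _ _) (le_max_right _ _)) hS
    have hbox : IsWindowBox reg b₀ ℓ k (2 * S + 1) s := ⟨hs, hs2⟩
    have hs0 : (0 : ℝ) < s 0 := by
      have h2 : 2 ≤ s 0 := le_trans hb₀ (hs 0).1
      exact_mod_cast (lt_of_lt_of_le (by norm_num) h2)
    have hτ : 0 < t / s 0 := div_pos ht0 hs0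
    have h0 : ENNReal.ofReal (P (fun U => HasSingularSeparator U (mq f) s (t / s 0))) ≤
        ∫⁻ U, (nearKernelCount U (mq f) s (t / s 0) : ℝ≥0∞) ∂(qcdLatticeMeasure N (reg.β k) mq) := by
      have h := hM N (reg.β k) mq (mq f) s (t / s 0) hτ
      rw [qcdPhaseQuenchedExpect_eq_div_prod] at h
      simpa only [P, wt] using h
    have h2 := hk₂ S hS₂ s hbox f t ht0 ht1
    have h1 := hk₁ S hS₁ s hbox f
    have hchain : ENNReal.ofReal (P (fun U => HasSingularSeparator U (mq f) s (t / s 0))) ≤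
        ENNReal.ofReal (C₂ * t * C₁) := by
      calc ENNReal.ofReal (P (fun U => HasSingularSeparator U (mq f) s (t / s 0)))
          ≤ ∫⁻ U, (nearKernelCount U (mq f) s (t / s 0) : ℝ≥0∞)
              ∂(qcdLatticeMeasure N (reg.β k) mq) := h0
        _ ≤ ENNReal.ofReal (C₂ * t) *
              ∫⁻ U, (nearKernelCount U (valenceMass reg m k f) s (2 * K / s 0) : ℝ≥0∞)
                ∂(qcdLatticeMeasure (2 * S + 1) (reg.β k) (valenceMass reg m k)) := h2
        _ ≤ ENNReal.ofReal (C₂ * t) * ENNReal.ofReal C₁ := by gcongr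
        _ = ENNReal.ofReal (C₂ * t * C₁) := (ENNReal.ofReal_mul (by positivity)).symm
    have hreal : P (fun U => HasSingularSeparator U (mq f) s (t / s 0)) ≤ C₂ * t * C₁ :=
      (ENNReal.ofReal_le_ofReal_iff (by positivity)).1 hchain
    calc P (fun U => HasSingularSeparator U (mq f) s (t / s 0)) ≤ C₂ * t * C₁ := hreal
      _ = C₁ * C₂ * t ^ (1 : ℝ) := by rw [Real.rpow_one]; ring
  · -- clause (ii): windowed local dilution, restricted to the larger physical size
    intro ε hε
    exact (hii ε hε).mono fun k hk S hS => hk S (le_trans (le_max_left _ _) hS)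
  · -- clause (iii): the parity pin, restricted to the larger physical size
    intro M hM'
    exact (hiii M hM').mono fun k hk S hS => hk S (le_trans (le_max_left _ _) hS)

/-- Repacking: the tail of `NegativeCellsDilute` at its witness IS `OnPhysicalBranch` (clauses (ii),(iii)
are `DilutionClause`/`PinClause` verbatim). -/
theorem onPhysicalBranch_of_negativeCellsDilute (h : NegativeCellsDilute) {Nf : ℕ} (hNf : Nf = 2 ∨ Nf = 3) :
    ∃ (reg : QCDRegularisation Nf) (M₀ : ℝ) (b₀ : ℕ) (ℓ : ℝ), OnPhysicalBranch Nf reg M₀ b₀ ℓ := by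
  obtain ⟨reg, hms, has, M₀, hM₀, b₀, hb₀, ℓ, hℓ, hbody⟩ := h Nf hNf
  refine ⟨reg, M₀, b₀, ℓ, hms, has, hM₀, hb₀, hℓ, fun m hm => ?_⟩
  obtain ⟨R, hR, hii, hiii⟩ := hbody m hm
  exact ⟨R, hR, hii, hiii⟩

/-- **The skeleton**: the five stubs prove the crux `CoerciveSea` BY NAME.
(D) puts a witness `(reg, M₀, b₀, ℓ)` on the physical branch; (A) and (S)∘(W) give the census and the
smearing there; `coerciveSeaAt_of_twoStep` with (M) assembles the crux body at `reg`
(`CoerciveSeaNegative.coerciveSea_iff` is `Iff.rfl`). -/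
theorem CoerciveSea_of : CoerciveSea := by
  intro Nf hNf
  obtain ⟨reg, M₀, b₀, ℓ, hb⟩ := onPhysicalBranch_of_negativeCellsDilute stub_dilutionPin hNf
  exact ⟨reg, coerciveSeaAt_of_twoStep stub_firstMoment hb
    (stub_mesoscopicCensus Nf hNf reg M₀ b₀ ℓ hb)
    (stub_moduliSmearing stub_transversalDwell Nf hNf reg M₀ b₀ ℓ hb)⟩

end Summit.QuantumFields.QCD.Cruxes.CoerciveSea.ModuliSpectralAveraging

end
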